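import Mathlib
import HarnessLib

/-!
# Flux reflection I: Cauchy–Schwarz for a positive semi-definite kernel form, and across an outer integral

Support module (`--supports` stmt-QuantumFields-24093, `QuantileBitPurity.EquatorBandVanishing`; seat ym-dw-p1 g17, LINE g12-B of ideator seat
ym-idea-4).  First of the abstract «flux reflection» modules (companions `QuantileBitPurityFluxReflectionWeights/Odd/Even`): on a finite measure space
`(Y, ρ)`, for a bounded measurable symmetric kernel `K` that is POSITIVE SEMI-DEFINITE as a bilinear form on bounded measurable functions
(the one-step transfer kernel of the thermal ring; tree `FemtoTransferGapPositivity`):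

* `form_abs_le_sqrt_mul_sqrt` — `|∫∫ φ K ψ| ≤ (∫∫ φ K φ)^{1/2} (∫∫ ψ K ψ)^{1/2}` (discriminant of `t ↦ ⟨φ − tψ, K(φ − tψ)⟩ ≥ 0`);
* `integral_sqrt_mul_sqrt_le` — `∫ √f √g ≤ (∫ f)^{1/2} (∫ g)^{1/2}` (Hölder at `(2,2)`); `integral_comp_eq_of_mp` (measure-preserving substitution);
* `inner_le_sqrt_mul_sqrt` — the pointwise Cauchy–Schwarz step for half-ring functions `Ψ(x,·) f` against `Ψ(·,y) g`;
* indicator bookkeeping (`abs_ind_le_one`, `ind_mul_self`, `measurable_flipInd`).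

Pure measure theory (Mathlib only).  HONEST FRAMING: inequalities between integrals; nothing about infinite volume, the continuum limit or the Clay gap.
No `sorry`, no new axiom, no new definition.  References: [folklore].
-/

set_option autoImplicit false

noncomputable section

open MeasureTheory Real Function Set

namespace Summit.QuantumFields.YangMills.Theorems.FemtoTransferGap.FluxReflection

variable {Y : Type*} [MeasurableSpace Y] {ρ : Measure Y} [IsFiniteMeasure ρ]

/-! ## §1 The positive kernel form `⟨φ, K ψ⟩ = ∫∫ φ(a) K(a,a') ψ(a')` on bounded measurable functions -/

section KernelForm

variable {K : Y → Y → ℝ} {CK : ℝ}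

/-- `a ↦ ∫ K(a,a') ψ(a') dρ(a')` is measurable for jointly measurable `K` and measurable `ψ`. [folklore] -/
theorem measurable_kernel_apply (hKm : Measurable (uncurry K)) {ψ : Y → ℝ} (hψ : Measurable ψ) :
    Measurable fun a => ∫ a', K a a' * ψ a' ∂ρ := by
  have h : StronglyMeasurable (uncurry fun a a' => K a a' * ψ a') := (hKm.mul (hψ.comp measurable_snd)).stronglyMeasurable
  exact (h.integral_prod_right (ν := ρ)).measurable

/-- `|∫ K(a,a') ψ(a') dρ(a')| ≤ C_K C_ψ ρ(Y)`. [folklore] -/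
theorem abs_kernel_apply_le (hKb : ∀ a a', |K a a'| ≤ CK) {ψ : Y → ℝ} {Cψ : ℝ} (hψb : ∀ a, |ψ a| ≤ Cψ) (a : Y) :
    |∫ a', K a a' * ψ a' ∂ρ| ≤ CK * Cψ * ρ.real univ := by
  have h := norm_integral_le_of_norm_le_const (μ := ρ) (f := fun a' => K a a' * ψ a') (C := CK * Cψ)
    (ae_of_all _ fun a' => by
      rw [Real.norm_eq_abs, abs_mul]
      exact mul_le_mul (hKb a a') (hψb a') (abs_nonneg _) ((abs_nonneg _).trans (hKb a a')))
  rw [Real.norm_eq_abs] at h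
  linarith [h]

omit [IsFiniteMeasure ρ] in
/-- The inner integral pulled out: `∫∫ φ(a) K(a,a') ψ(a') = ∫ φ(a) (∫ K(a,a') ψ(a'))`. [folklore] -/
theorem form_eq_integral_mul_apply (φ ψ : Y → ℝ) :
    ∫ a, ∫ a', φ a * K a a' * ψ a' ∂ρ ∂ρ = ∫ a, φ a * ∫ a', K a a' * ψ a' ∂ρ ∂ρ := by
  refine integral_congr_ae (ae_of_all _ fun a => ?_)
  dsimp only
  rw [← integral_const_mul]
  refine integral_congr_ae (ae_of_all _ fun a' => ?_)
  ring

/-- Integrability of `φ · (K ψ)` for bounded measurable data. [folklore] -/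
theorem integrable_mul_kernel_apply (hKm : Measurable (uncurry K)) (hKb : ∀ a a', |K a a'| ≤ CK)
    {φ ψ : Y → ℝ} (hφ : Measurable φ) (hψ : Measurable ψ) {Cφ Cψ : ℝ} (hφb : ∀ a, |φ a| ≤ Cφ) (hψb : ∀ a, |ψ a| ≤ Cψ) :
    Integrable (fun a => φ a * ∫ a', K a a' * ψ a' ∂ρ) ρ := by
  refine Integrable.of_bound ((hφ.mul (measurable_kernel_apply hKm hψ)).aestronglyMeasurable) (Cφ * (CK * Cψ * ρ.real univ))
    (ae_of_all _ fun a => ?_)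
  rw [Real.norm_eq_abs, abs_mul]
  exact mul_le_mul (hφb a) (abs_kernel_apply_le hKb hψb a) (abs_nonneg _) ((abs_nonneg _).trans (hφb a))

/-- **Symmetry of the form** for a symmetric kernel: `∫∫ φ K ψ = ∫∫ ψ K φ` (Fubini). [folklore] -/
theorem form_symm (hKm : Measurable (uncurry K)) (hKb : ∀ a a', |K a a'| ≤ CK) (hKs : ∀ a a', K a a' = K a' a)
    {φ ψ : Y → ℝ} (hφ : Measurable φ) (hψ : Measurable ψ) {Cφ Cψ : ℝ} (hφb : ∀ a, |φ a| ≤ Cφ) (hψb : ∀ a, |ψ a| ≤ Cψ) :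
    ∫ a, ∫ a', φ a * K a a' * ψ a' ∂ρ ∂ρ = ∫ a, ∫ a', ψ a * K a a' * φ a' ∂ρ ∂ρ := by
  have hint : Integrable (uncurry fun a a' => φ a * K a a' * ψ a') (ρ.prod ρ) := by
    have hm : Measurable (uncurry fun a a' => φ a * K a a' * ψ a') := ((hφ.comp measurable_fst).mul hKm).mul (hψ.comp measurable_snd)
    refine Integrable.of_bound hm.aestronglyMeasurable (Cφ * CK * Cψ) (ae_of_all _ fun p => ?_)
    rw [uncurry_apply_pair, Real.norm_eq_abs, abs_mul, abs_mul]
    have h0 : 0 ≤ Cφ := (abs_nonneg _).trans (hφb p.1)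
    exact mul_le_mul (mul_le_mul (hφb _) (hKb _ _) (abs_nonneg _) h0) (hψb _) (abs_nonneg _) (mul_nonneg h0 ((abs_nonneg _).trans (hKb p.1 p.2)))
  rw [integral_integral_swap hint]
  refine integral_congr_ae (ae_of_all _ fun a' => integral_congr_ae (ae_of_all _ fun a => ?_))
  dsimp only
  rw [hKs a a']
  ring

/-- Linearity of the form in the first slot: `∫∫ (φ + c χ) K ψ = ∫∫ φ K ψ + c ∫∫ χ K ψ`. [folklore] -/
theorem form_add_smul_left (hKm : Measurable (uncurry K)) (hKb : ∀ a a', |K a a'| ≤ CK)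
    {φ χ ψ : Y → ℝ} (hφ : Measurable φ) (hχ : Measurable χ) (hψ : Measurable ψ) {Cφ Cχ Cψ : ℝ}
    (hφb : ∀ a, |φ a| ≤ Cφ) (hχb : ∀ a, |χ a| ≤ Cχ) (hψb : ∀ a, |ψ a| ≤ Cψ) (c : ℝ) :
    ∫ a, ∫ a', (φ a + c * χ a) * K a a' * ψ a' ∂ρ ∂ρ =
      (∫ a, ∫ a', φ a * K a a' * ψ a' ∂ρ ∂ρ) + c * ∫ a, ∫ a', χ a * K a a' * ψ a' ∂ρ ∂ρ := by
  rw [form_eq_integral_mul_apply, form_eq_integral_mul_apply, form_eq_integral_mul_apply]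
  have h1 := integrable_mul_kernel_apply (ρ := ρ) hKm hKb hφ hψ hφb hψb
  have h2 := integrable_mul_kernel_apply (ρ := ρ) hKm hKb hχ hψ hχb hψb
  rw [← integral_const_mul, ← integral_add h1 (h2.const_mul c)]
  refine integral_congr_ae (ae_of_all _ fun a => ?_)
  dsimp only
  ring

/-- **Cauchy–Schwarz for a positive semi-definite symmetric kernel form** on bounded measurable functions:
`|∫∫ φ K ψ| ≤ (∫∫ φ K φ)^{1/2} (∫∫ ψ K ψ)^{1/2}` (the discriminant of `t ↦ ⟨φ − tψ, K(φ − tψ)⟩ ≥ 0`). [folklore] -/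
theorem form_abs_le_sqrt_mul_sqrt (hKm : Measurable (uncurry K)) (hKb : ∀ a a', |K a a'| ≤ CK) (hKs : ∀ a a', K a a' = K a' a)
    (hPD : ∀ φ : Y → ℝ, Measurable φ → ∀ C : ℝ, (∀ a, |φ a| ≤ C) → 0 ≤ ∫ a, ∫ a', φ a * K a a' * φ a' ∂ρ ∂ρ)
    {φ ψ : Y → ℝ} (hφ : Measurable φ) (hψ : Measurable ψ) {Cφ Cψ : ℝ} (hφb : ∀ a, |φ a| ≤ Cφ) (hψb : ∀ a, |ψ a| ≤ Cψ) :
    |∫ a, ∫ a', φ a * K a a' * ψ a' ∂ρ ∂ρ| ≤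
      Real.sqrt (∫ a, ∫ a', φ a * K a a' * φ a' ∂ρ ∂ρ) * Real.sqrt (∫ a, ∫ a', ψ a * K a a' * ψ a' ∂ρ ∂ρ) := by
  set P : ℝ := ∫ a, ∫ a', φ a * K a a' * φ a' ∂ρ ∂ρ with hP
  set Q : ℝ := ∫ a, ∫ a', ψ a * K a a' * ψ a' ∂ρ ∂ρ with hQ
  set B : ℝ := ∫ a, ∫ a', φ a * K a a' * ψ a' ∂ρ ∂ρ with hB
  have hP0 : 0 ≤ P := hPD φ hφ Cφ hφb
  have hQ0 : 0 ≤ Q := hPD ψ hψ Cψ hψb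
  -- the quadratic `t ↦ ⟨φ − tψ, K(φ − tψ)⟩ = Q t² − 2 B t + P ≥ 0`
  have hquad : ∀ t : ℝ, 0 ≤ Q * (t * t) + (-2 * B) * t + P := by
    intro t
    have hm : Measurable fun a => φ a + (-t) * ψ a := hφ.add (hψ.const_mul _)
    have hb : ∀ a, |φ a + (-t) * ψ a| ≤ Cφ + |t| * Cψ := fun a => by
      calc |φ a + (-t) * ψ a| ≤ |φ a| + |(-t) * ψ a| := abs_add_le _ _
        _ ≤ Cφ + |t| * Cψ := by rw [abs_mul, abs_neg]; exact add_le_add (hφb a) (mul_le_mul_of_nonneg_left (hψb a) (abs_nonneg t))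
    have h0 := hPD (fun a => φ a + (-t) * ψ a) hm _ hb
    -- expand
    have e1 : ∫ a, ∫ a', (φ a + (-t) * ψ a) * K a a' * (φ a' + (-t) * ψ a') ∂ρ ∂ρ =
        (∫ a, ∫ a', φ a * K a a' * (φ a' + (-t) * ψ a') ∂ρ ∂ρ) + (-t) * ∫ a, ∫ a', ψ a * K a a' * (φ a' + (-t) * ψ a') ∂ρ ∂ρ :=
      form_add_smul_left hKm hKb hφ hψ hm hφb hψb hb (-t)
    have e2 : ∫ a, ∫ a', φ a * K a a' * (φ a' + (-t) * ψ a') ∂ρ ∂ρ = P + (-t) * B := by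
      rw [form_symm hKm hKb hKs hφ hm hφb hb, form_add_smul_left hKm hKb hφ hψ hφ hφb hψb hφb (-t), hP, hB,
        form_symm hKm hKb hKs hψ hφ hψb hφb]
    have e3 : ∫ a, ∫ a', ψ a * K a a' * (φ a' + (-t) * ψ a') ∂ρ ∂ρ = B + (-t) * Q := by
      rw [form_symm hKm hKb hKs hψ hm hψb hb, form_add_smul_left hKm hKb hφ hψ hψ hφb hψb hψb (-t), hB, hQ]
    rw [e1, e2, e3] at h0
    nlinarith [h0]
  have hdisc := discrim_le_zero hquad
  rw [discrim] at hdisc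
  have hB2 : B ^ 2 ≤ P * Q := by nlinarith [hdisc]
  calc |B| ≤ Real.sqrt (P * Q) := Real.abs_le_sqrt hB2
    _ = Real.sqrt P * Real.sqrt Q := Real.sqrt_mul hP0 Q

end KernelForm

/-! ## §2 Cauchy–Schwarz across the outer integral -/

/-- `∫ √f √g ≤ (∫ f)^{1/2} (∫ g)^{1/2}` for bounded measurable `f, g ≥ 0` on a finite measure space. [folklore] -/
theorem integral_sqrt_mul_sqrt_le {f g : Y → ℝ} (hf : Measurable f) (hg : Measurable g) (hf0 : ∀ x, 0 ≤ f x) (hg0 : ∀ x, 0 ≤ g x)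
    {Cf Cg : ℝ} (hfb : ∀ x, f x ≤ Cf) (hgb : ∀ x, g x ≤ Cg) :
    ∫ x, Real.sqrt (f x) * Real.sqrt (g x) ∂ρ ≤ Real.sqrt (∫ x, f x ∂ρ) * Real.sqrt (∫ x, g x ∂ρ) := by
  have hmf : MemLp (fun x => Real.sqrt (f x)) (ENNReal.ofReal 2) ρ := by
    refine MemLp.of_bound (hf.sqrt.aestronglyMeasurable) (Real.sqrt Cf) (ae_of_all _ fun x => ?_)
    rw [Real.norm_eq_abs, abs_of_nonneg (Real.sqrt_nonneg _)]
    exact Real.sqrt_le_sqrt (hfb x)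
  have hmg : MemLp (fun x => Real.sqrt (g x)) (ENNReal.ofReal 2) ρ := by
    refine MemLp.of_bound (hg.sqrt.aestronglyMeasurable) (Real.sqrt Cg) (ae_of_all _ fun x => ?_)
    rw [Real.norm_eq_abs, abs_of_nonneg (Real.sqrt_nonneg _)]
    exact Real.sqrt_le_sqrt (hgb x)
  have h := integral_mul_le_Lp_mul_Lq_of_nonneg (μ := ρ) Real.HolderConjugate.two_two
    (ae_of_all _ fun x => Real.sqrt_nonneg (f x)) (ae_of_all _ fun x => Real.sqrt_nonneg (g x)) hmf hmg
  have e1 : (fun x => Real.sqrt (f x) ^ (2 : ℝ)) = f := by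
    funext x; rw [Real.rpow_two, Real.sq_sqrt (hf0 x)]
  have e2 : (fun x => Real.sqrt (g x) ^ (2 : ℝ)) = g := by
    funext x; rw [Real.rpow_two, Real.sq_sqrt (hg0 x)]
  rw [e1, e2] at h
  rw [Real.sqrt_eq_rpow, Real.sqrt_eq_rpow]
  simpa only [one_div] using h

omit [IsFiniteMeasure ρ] in
/-- Change of variables under a measure-preserving map: `∫ F(T x) dρ = ∫ F dρ` for measurable `F`. [folklore] -/
theorem integral_comp_eq_of_mp {T : Y → Y} (hT : MeasurePreserving T ρ ρ) {F : Y → ℝ} (hF : Measurable F) :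
    ∫ x, F (T x) ∂ρ = ∫ x, F x ∂ρ := by
  have h := integral_map (μ := ρ) hT.measurable.aemeasurable (f := F) (hF.aestronglyMeasurable)
  rw [hT.map_eq] at h
  exact h.symm

/-! ## §3 The pointwise Cauchy–Schwarz step for two half-ring functions -/

section Inner

variable {Ψ K : Y → Y → ℝ} {CΨ CK : ℝ} {T : Y → Y} {O : Y → ℝ} {B : Set Y} {Cl : Set (Y × Y)}

/-- Pointwise Cauchy–Schwarz step of §3: for fixed outer points, `⟨Ψ(x,·)F, K(Ψ(·,y)G)⟩ ≤ ⟨Ψ(x,·)F, K(Ψ(x,·)F)⟩^{1/2} ⟨Ψ(·,y)G, K(Ψ(·,y)G)⟩^{1/2}`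
(`F, G` indicator-type weights with values in `[0,1]`). [folklore] -/
theorem inner_le_sqrt_mul_sqrt (hΨm : Measurable (uncurry Ψ)) (hΨb : ∀ x a, |Ψ x a| ≤ CΨ)
    (hKm : Measurable (uncurry K)) (hKb : ∀ a a', |K a a'| ≤ CK) (hKs : ∀ a a', K a a' = K a' a)
    (hPD : ∀ φ : Y → ℝ, Measurable φ → ∀ C : ℝ, (∀ a, |φ a| ≤ C) → 0 ≤ ∫ a, ∫ a', φ a * K a a' * φ a' ∂ρ ∂ρ)
    {f g : Y → ℝ} (hf : Measurable f) (hg : Measurable g) (hfb : ∀ a, |f a| ≤ 1) (hgb : ∀ a, |g a| ≤ 1) (x y : Y) :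
    ∫ a, (Ψ x a * f a) * ∫ a', K a a' * (Ψ a' y * g a') ∂ρ ∂ρ ≤
      Real.sqrt (∫ a, (Ψ x a * f a) * ∫ a', K a a' * (Ψ x a' * f a') ∂ρ ∂ρ) *
        Real.sqrt (∫ a, (Ψ a y * g a) * ∫ a', K a a' * (Ψ a' y * g a') ∂ρ ∂ρ) := by
  have hC0 : 0 ≤ CΨ := (abs_nonneg _).trans (hΨb x x)
  have hφm : Measurable fun a => Ψ x a * f a := (hΨm.comp (measurable_const.prodMk measurable_id)).mul hf
  have hψm : Measurable fun a => Ψ a y * g a := (hΨm.comp (measurable_id.prodMk measurable_const)).mul hg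
  have hφb : ∀ a, |Ψ x a * f a| ≤ CΨ := fun a => by
    rw [abs_mul]; exact (mul_le_mul (hΨb x a) (hfb a) (abs_nonneg _) hC0).trans (by rw [mul_one])
  have hψb : ∀ a, |Ψ a y * g a| ≤ CΨ := fun a => by
    rw [abs_mul]; exact (mul_le_mul (hΨb a y) (hgb a) (abs_nonneg _) hC0).trans (by rw [mul_one])
  have h := form_abs_le_sqrt_mul_sqrt (ρ := ρ) hKm hKb hKs hPD hφm hψm hφb hψb
  rw [form_eq_integral_mul_apply, form_eq_integral_mul_apply, form_eq_integral_mul_apply] at h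
  exact (le_abs_self _).trans h

end Inner

/-! ## Indicator bookkeeping -/

omit [MeasurableSpace Y] in
/-- `|𝟙_s| ≤ 1`. [folklore] -/
theorem abs_ind_le_one (s : Set Y) (y : Y) : |s.indicator (fun _ => (1 : ℝ)) y| ≤ 1 := by
  by_cases h : y ∈ s
  · rw [Set.indicator_of_mem h]; simp
  · rw [Set.indicator_of_notMem h]; simp

omit [MeasurableSpace Y] in
/-- `𝟙_s ≤ 1`. [folklore] -/
theorem ind_le_one (s : Set Y) (y : Y) : s.indicator (fun _ => (1 : ℝ)) y ≤ 1 :=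
  (le_abs_self _).trans (abs_ind_le_one s y)

omit [MeasurableSpace Y] in
/-- `0 ≤ 𝟙_s`. [folklore] -/
theorem ind_nonneg (s : Set Y) (y : Y) : 0 ≤ s.indicator (fun _ => (1 : ℝ)) y := Set.indicator_nonneg (fun _ _ => zero_le_one) _

omit [MeasurableSpace Y] in
/-- `𝟙_s · 𝟙_s = 𝟙_s`. [folklore] -/
theorem ind_mul_self (s : Set Y) (y : Y) : s.indicator (fun _ => (1 : ℝ)) y * s.indicator (fun _ => (1 : ℝ)) y = s.indicator (fun _ => (1 : ℝ)) y := by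
  by_cases h : y ∈ s
  · rw [Set.indicator_of_mem h]; simp
  · rw [Set.indicator_of_notMem h]; simp

/-- The flip indicator `(x, b) ↦ 𝟙{O b ≠ O x}` is jointly measurable. [folklore] -/
theorem measurable_flipInd {O : Y → ℝ} (hOm : Measurable O) :
    Measurable fun p : Y × Y => {b | O b ≠ O p.1}.indicator (fun _ => (1 : ℝ)) p.2 := by
  have h : (fun p : Y × Y => {b | O b ≠ O p.1}.indicator (fun _ => (1 : ℝ)) p.2) = {p : Y × Y | O p.2 ≠ O p.1}.indicator fun _ => (1 : ℝ) := by
    funext p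
    simp only [Set.indicator_apply, Set.mem_setOf_eq]
  rw [h]
  exact measurable_const.indicator ((measurableSet_eq_fun (hOm.comp measurable_snd) (hOm.comp measurable_fst)).compl)

end Summit.QuantumFields.YangMills.Theorems.FemtoTransferGap.FluxReflection

end
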